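import Mathlib
import Literature.AlgebraicGeometry.Resolution.BlowupPrincipalCharts
import Summits.ResolutionOfSingularities.ResolutionOfSingularities.Theorems.WildQuotientsWildQuotientResolutionPrincipalChartRees
import Summits.ResolutionOfSingularities.ResolutionOfSingularities.Theorems.WildQuotientsWildQuotientResolutionJordanFourCoverThree
import Summits.ResolutionOfSingularities.ResolutionOfSingularities.Theorems.WildQuotientsWildQuotientResolutionToricExitCover
import HarnessLib

/-!
# Programme V4U, package T2 (c): the section `θ` on `D₊(T't)`, `W_T = D(θ)`, and `σ̃`-stability of `D₊(T't)` and `W_T`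

(crux stmt-ResolutionOfSingularities-15640 `WildQuotients.WildQuotientResolution`, line `Sketch`,
sector `|G| = p`; programme V4U of `L/w45c/CHAIN.md` v6 §4 row stub-2, design of record
`L/w45c/V4U-DESIGN.md` §3/§5 (T2 (c) «σ̃-stability of `D₊(T't)` and of `W_T`»); [OURS · L1 W4.5c] — NOT a
statement of any manuscript; replaces the role of no printed item.)

`V = Bl_{(g)} 𝔸ⁿ`, `g : Fin 8 → k[x]` the ABSTRACT `I₆`-vector (`g j =` the monomials of record; instantiate
with the vector of record and `rfl`, see `…JordanFourI6Abstract`). On the Rees chart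
`U_T = D₊(T't) = chartι_{T'}(Spec B_T)` the element `θ = (H'³t²)/(T't)² ∈ B_T` becomes the section
`θ̃ = τ θ ∈ Γ(V, U_T)`, `τ = (chartι_{T'}.appIso ⊤)⁻¹ ∘ ΓSpecIso⁻¹ : B_T → Γ(V, U_T)` (so `τ(F/1) = π^*F|_{U_T}`,
`tau_reesChartBase`), with `θ̃ · π^*(T'²) = π^*(H'³)` (`tau_theta_mul_pull`). This file proves

* `basicOpen_tau_theta_eq` — **`V.basicOpen θ̃ = D₊(T't) ⊓ D₊(H'³t²) = W_T`** (the open of record of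
  `…JordanFourCoverThree`); hence `Γ(V, W_T)` is the localisation of `Γ(V, U_T) ≅ B_T` at `θ`;
* for ANY action `ρ'` on `V` over an action `ρ` on `𝔸ⁿ` preserving the ideal sheaf of `(g)` and fixing
  `T'` and `H'` (the lifted `J₄`-action: `…I6StableJ4`, `JordanFour.smul_Tprime`/`smul_Hprime` below):
  `U_T` is stable (`preimage_chartOpenT_eq_self`), `θ̃` is an invariant section
  (`appLE_tau_theta_eq_self`: both `π^*T'²` and `π^*H'³` are invariant and `π^*T'` is a non-zero-divisor),
  and **`W_T` is stable** (`preimage_chartT_eq_self`);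
* the `J₄`-invariance of `T'`, `H'`, `x_a²` under `⟨σ⟩` (pure algebra).
-/

-- single-problem summit: the doubled namespace component `ResolutionOfSingularities` is forced
set_option linter.dupNamespace false

noncomputable section

open MvPolynomial CategoryTheory AlgebraicGeometry TopologicalSpace HomogeneousLocalization
open Literature.AlgebraicGeometry.Resolution

namespace Summit.ResolutionOfSingularities.ResolutionOfSingularities.Theorems.WildQuotientResolution.JordanFour

universe u

section Theta

variable (k : Type) [Field k] (n : ℕ) (a b c d : Fin n) (g : Fin 8 → MvPolynomial (Fin n) k)
  (hg0 : g 0 = X a ^ 2) (hg1 : g 1 = X a * X b ^ 2) (hg2 : g 2 = X a * X b * X c) (hg3 : g 3 = X a * X c ^ 3)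
  (hg4 : g 4 = X b ^ 3) (hg5 : g 5 = X b ^ 2 * X c ^ 2) (hg6 : g 6 = X b * X c ^ 4) (hg7 : g 7 = X c ^ 6)

local notation3 "I6" => Ideal.span (Set.range g)
local notation3 "Tp" => (X b ^ 3 - 3 * X a * X b * X c + 3 * X a ^ 2 * X d - X a ^ 2 * X b :
  MvPolynomial (Fin n) k)
local notation3 "Hp" => (X b ^ 2 - X a * X b - 2 * X a * X c : MvPolynomial (Fin n) k)
local notation3 "hT" => Tprime_mem_span k n a b c d g hg0 hg1 hg2 hg3 hg4 hg5 hg6 hg7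
local notation3 "hH3" => Hcube_mem_span_sq k n a b c g hg0 hg1 hg2 hg3 hg4 hg5 hg6
/-- the degree-two numerator `H'³ t²` -/
local notation3 (prettyPrint := false) "H3num" =>
  (⟨Polynomial.monomial 2 (Hp ^ 3), reesAlgebra.monomial_mem.mpr hH3⟩ : reesAlgebra I6)
/-- the Rees chart ring `B_T` at `T'` -/
local notation3 "BT" => HomogeneousLocalization.Away (reesGrading I6) (reesT Tp hT)
/-- `θ = (H'³t²)/(T't)²` -/
local notation3 (prettyPrint := false) "θT" =>
  HomogeneousLocalization.Away.mk (reesGrading I6) (reesT_mem Tp hT) 2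
    (⟨Polynomial.monomial 2 (Hp ^ 3), reesAlgebra.monomial_mem.mpr hH3⟩ : reesAlgebra I6)
    (monomial_two_mem_reesGrading k n g (Hp ^ 3) hH3)
/-- the chart `U_T = D₊(T't) = chartι_{T'}(Spec B_T)` as an open of `V` -/
local notation3 (prettyPrint := false) "UT" =>
  (affineBlowup.chartι (I := I6) Tp hT ''ᵁ (⊤ : (Spec (CommRingCat.of BT)).Opens))
/-- the transport `τ : B_T → Γ(V, U_T)` -/
local notation3 (prettyPrint := false) "τ" =>
  (((affineBlowup.chartι (I := I6) Tp hT).appIso ⊤).inv.hom.comp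
    (Scheme.ΓSpecIso (CommRingCat.of BT)).inv.hom : BT →+* Γ(affineBlowup I6, UT))

include hg0 hg1 hg2 hg3 hg4 hg5 hg6 hg7 in
/-- `τ(F/1) = π^*F|_{U_T}`: the transport of the structure map is the pull-back. [folklore] -/
theorem tau_reesChartBase (F : MvPolynomial (Fin n) k) :
    τ (reesChartBase Tp hT F) = affineBlowup.pull I6 UT F := by
  change ((affineBlowup.chartι (I := I6) Tp hT).appIso ⊤).inv
      ((Scheme.ΓSpecIso (CommRingCat.of BT)).inv (reesChartBase Tp hT F)) = _
  rw [← affineBlowup.appIso_hom_pull, Iso.hom_inv_id_apply]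
  rfl

include hg0 hg1 hg2 hg3 hg4 hg5 hg6 hg7 in
-- scheme-level bookkeeping on `Proj` sections: individually routine, but the types are large
set_option maxHeartbeats 800000 in
/-- **`θ̃ · π^*(T'²) = π^*(H'³)` on `U_T`** (transport of `θ · (T'/1)² = H'³/1`). [folklore] -/
theorem tau_theta_mul_pull :
    τ θT * affineBlowup.pull I6 UT (Tp ^ 2) = affineBlowup.pull I6 UT (Hp ^ 3) := by
  have h := awayMk_mul_reesChartBase_pow k n g Tp hT (monomial_two_mem_reesGrading k n g (Hp ^ 3) hH3)
    (r := Hp ^ 3) rfl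
  have e1 := tau_reesChartBase k n a b c d g hg0 hg1 hg2 hg3 hg4 hg5 hg6 hg7 (Tp ^ 2)
  have e2 := tau_reesChartBase k n a b c d g hg0 hg1 hg2 hg3 hg4 hg5 hg6 hg7 (Hp ^ 3)
  calc _ = τ θT * τ (reesChartBase Tp hT (Tp ^ 2)) := congrArg (fun x => τ θT * x) e1.symm
    _ = τ (θT * reesChartBase Tp hT (Tp ^ 2)) := (RingHom.map_mul _ _ _).symm
    _ = τ (reesChartBase Tp hT (Hp ^ 3)) := congrArg (fun x => τ x) h
    _ = _ := e2

include hg0 hg1 hg2 hg3 hg4 hg5 hg6 hg7 in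
-- scheme-level bookkeeping on `Proj` sections: individually routine, but the types are large
set_option maxHeartbeats 800000 in
/-- **`W_T = V.basicOpen θ̃`**: the non-vanishing locus of the section `θ̃` of `U_T = D₊(T't)` is
`D₊(T't) ⊓ D₊(H'³t²)` (through `chartι`, `D(θ) = chartι⁻¹ D₊(H'³t²)` by Mathlib's
`Proj.awayι_preimage_basicOpen`). [folklore] -/
theorem basicOpen_tau_theta_eq :
    (affineBlowup I6).basicOpen (τ θT) =
      Proj.basicOpen (reesGrading I6) (reesT Tp hT) ⊓
        Proj.basicOpen (reesGrading I6)
          (⟨Polynomial.monomial 2 (Hp ^ 3), reesAlgebra.monomial_mem.mpr hH3⟩ : reesAlgebra I6) := by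
  -- through the chart: `V.basicOpen (τ θ) = chartι '' D(θ)`
  have h1 : (affineBlowup I6).basicOpen (τ θT) =
      affineBlowup.chartι (I := I6) Tp hT ''ᵁ
        (Spec (CommRingCat.of BT)).basicOpen ((Scheme.ΓSpecIso (CommRingCat.of BT)).inv θT) := by
    change (affineBlowup I6).basicOpen (((affineBlowup.chartι (I := I6) Tp hT).appIso ⊤).inv
      ((Scheme.ΓSpecIso (CommRingCat.of BT)).inv θT)) = _
    rw [← Scheme.image_basicOpen]
  have h2 : (Spec (CommRingCat.of BT)).basicOpen ((Scheme.ΓSpecIso (CommRingCat.of BT)).inv θT) =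
      PrimeSpectrum.basicOpen θT := basicOpen_eq_of_affine _
  -- `chartι⁻¹ D₊(H'³t²) = D(θ)`
  have hθ : Away.isLocalizationElem (reesT_mem Tp hT) (monomial_two_mem_reesGrading k n g (Hp ^ 3) hH3) =
      θT := by
    apply HomogeneousLocalization.val_injective
    simp only [HomogeneousLocalization.Away.val_mk, pow_one, smul_eq_mul, mul_one]
  have h3 : affineBlowup.chartι (I := I6) Tp hT ⁻¹ᵁ Proj.basicOpen (reesGrading I6)
      (⟨Polynomial.monomial 2 (Hp ^ 3), reesAlgebra.monomial_mem.mpr hH3⟩ : reesAlgebra I6) =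
      PrimeSpectrum.basicOpen θT := by
    rw [← hθ]
    exact Proj.awayι_preimage_basicOpen (reesGrading I6) (reesT_mem Tp hT) one_pos
      (monomial_two_mem_reesGrading k n g (Hp ^ 3) hH3) (by norm_num)
  have h4 : (affineBlowup.chartι (I := I6) Tp hT).opensRange = Proj.basicOpen (reesGrading I6) (reesT Tp hT) := by
    rw [← Scheme.Hom.image_top_eq_opensRange, affineBlowup.image_top_chartι]
  rw [h1, h2, ← h3, Scheme.Hom.image_preimage_eq_opensRange_inf, h4]

include hg0 hg1 hg2 hg3 hg4 hg5 hg6 hg7 in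
/-- `V.basicOpen θ̃` is the open of record `W_T = D₊(T't · H'³t²)`. [folklore] -/
theorem basicOpen_tau_theta_eq_chartT :
    (affineBlowup I6).basicOpen (τ θT) =
      Proj.basicOpen (reesGrading I6) (reesT Tp hT *
        (⟨Polynomial.monomial 2 (Hp ^ 3), reesAlgebra.monomial_mem.mpr hH3⟩ : reesAlgebra I6)) := by
  rw [basicOpen_tau_theta_eq k n a b c d g hg0 hg1 hg2 hg3 hg4 hg5 hg6 hg7,
    chartT_eq_inf k n a b c d g hg0 hg1 hg2 hg3 hg4 hg5 hg6 hg7]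

end Theta

section Stability

variable (k : Type) [Field k] (n : ℕ) (a b c d : Fin n) (g : Fin 8 → MvPolynomial (Fin n) k)
  (hg0 : g 0 = X a ^ 2) (hg1 : g 1 = X a * X b ^ 2) (hg2 : g 2 = X a * X b * X c) (hg3 : g 3 = X a * X c ^ 3)
  (hg4 : g 4 = X b ^ 3) (hg5 : g 5 = X b ^ 2 * X c ^ 2) (hg6 : g 6 = X b * X c ^ 4) (hg7 : g 7 = X c ^ 6)
  {G : Type*} [Group G]
  (ρ : G →* Aut (Spec (CommRingCat.of (MvPolynomial (Fin n) k))))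
  (ρ' : G →* Aut (affineBlowup (Ideal.span (Set.range g))))
  (hequiv : ∀ γ : G, (ρ' γ).hom ≫ affineBlowup.π (Ideal.span (Set.range g)) =
    affineBlowup.π (Ideal.span (Set.range g)) ≫ (ρ γ).hom)
  (hI : ∀ γ : G, (affineBlowup.idealSheaf (Ideal.span (Set.range g))).comap (ρ γ).hom =
    affineBlowup.idealSheaf (Ideal.span (Set.range g)))

local notation3 "I6" => Ideal.span (Set.range g)
local notation3 "Tp" => (X b ^ 3 - 3 * X a * X b * X c + 3 * X a ^ 2 * X d - X a ^ 2 * X b :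
  MvPolynomial (Fin n) k)
local notation3 "Hp" => (X b ^ 2 - X a * X b - 2 * X a * X c : MvPolynomial (Fin n) k)
local notation3 "hT" => Tprime_mem_span k n a b c d g hg0 hg1 hg2 hg3 hg4 hg5 hg6 hg7
local notation3 "hH3" => Hcube_mem_span_sq k n a b c g hg0 hg1 hg2 hg3 hg4 hg5 hg6
local notation3 "BT" => HomogeneousLocalization.Away (reesGrading I6) (reesT Tp hT)
local notation3 (prettyPrint := false) "θT" =>
  HomogeneousLocalization.Away.mk (reesGrading I6) (reesT_mem Tp hT) 2
    (⟨Polynomial.monomial 2 (Hp ^ 3), reesAlgebra.monomial_mem.mpr hH3⟩ : reesAlgebra I6)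
    (monomial_two_mem_reesGrading k n g (Hp ^ 3) hH3)
local notation3 (prettyPrint := false) "UT" =>
  (affineBlowup.chartι (I := I6) Tp hT ''ᵁ (⊤ : (Spec (CommRingCat.of BT)).Opens))
local notation3 (prettyPrint := false) "τ" =>
  (((affineBlowup.chartι (I := I6) Tp hT).appIso ⊤).inv.hom.comp
    (Scheme.ΓSpecIso (CommRingCat.of BT)).inv.hom : BT →+* Γ(affineBlowup I6, UT))

include hequiv hI in
/-- **`U_T = D₊(T't)` is stable** when `T'` is fixed downstairs. [folklore] -/
theorem preimage_chartOpenT_eq_self (hfixT : ∀ γ : G, (ρ γ).hom.appTop ((Scheme.ΓSpecIso (CommRingCat.of (MvPolynomial (Fin n) k))).inv Tp) =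
      (Scheme.ΓSpecIso (CommRingCat.of (MvPolynomial (Fin n) k))).inv Tp) (γ : G) : (ρ' γ).hom ⁻¹ᵁ UT = UT := by
  have h := ToricExit.preimage_basicOpen_reesT_eq_self_of_action ρ ρ' hequiv hI hT hfixT γ
  rw [affineBlowup.image_top_chartι]
  exact h

include hequiv hI in
-- scheme-level bookkeeping on `Proj` sections: individually routine, but the types are large
set_option maxHeartbeats 800000 in
/-- **`θ̃` is an invariant section of `U_T`**: `(ρ' γ)^* θ̃ = θ̃` (both `π^*T'²` and `π^*H'³` are invariant,
`θ̃ · π^*T'² = π^*H'³`, and `π^*T'` is a non-zero-divisor on `U_T`). [folklore] -/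
theorem appLE_tau_theta_eq_self (hfixT : ∀ γ : G, (ρ γ).hom.appTop ((Scheme.ΓSpecIso (CommRingCat.of (MvPolynomial (Fin n) k))).inv Tp) =
      (Scheme.ΓSpecIso (CommRingCat.of (MvPolynomial (Fin n) k))).inv Tp) (hfixH : ∀ γ : G, (ρ γ).hom.appTop ((Scheme.ΓSpecIso (CommRingCat.of (MvPolynomial (Fin n) k))).inv Hp) =
      (Scheme.ΓSpecIso (CommRingCat.of (MvPolynomial (Fin n) k))).inv Hp) (γ : G) :
    (ρ' γ).hom.appLE UT UT
        (preimage_chartOpenT_eq_self k n a b c d g hg0 hg1 hg2 hg3 hg4 hg5 hg6 hg7 ρ ρ' hequiv hI hfixT γ).ge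
      (τ θT) = τ θT := by
  have hU := preimage_chartOpenT_eq_self k n a b c d g hg0 hg1 hg2 hg3 hg4 hg5 hg6 hg7 ρ ρ' hequiv hI hfixT γ
  have hT2 : (ρ' γ).hom.appLE UT UT hU.ge (affineBlowup.pull I6 UT (Tp ^ 2)) =
      affineBlowup.pull I6 UT (Tp ^ 2) :=
    ToricExit.appLE_pull_eq_self_of_action ρ ρ' hequiv UT γ hU (Tp ^ 2)
      (by rw [map_pow, map_pow, hfixT γ])
  have hH3' : (ρ' γ).hom.appLE UT UT hU.ge (affineBlowup.pull I6 UT (Hp ^ 3)) =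
      affineBlowup.pull I6 UT (Hp ^ 3) :=
    ToricExit.appLE_pull_eq_self_of_action ρ ρ' hequiv UT γ hU (Hp ^ 3)
      (by rw [map_pow, map_pow, hfixH γ])
  have key := tau_theta_mul_pull k n a b c d g hg0 hg1 hg2 hg3 hg4 hg5 hg6 hg7
  have h1 : (ρ' γ).hom.appLE UT UT hU.ge (τ θT) * affineBlowup.pull I6 UT (Tp ^ 2) =
      τ θT * affineBlowup.pull I6 UT (Tp ^ 2) :=
    calc _ = (ρ' γ).hom.appLE UT UT hU.ge (τ θT) *
          (ρ' γ).hom.appLE UT UT hU.ge (affineBlowup.pull I6 UT (Tp ^ 2)) :=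
          congrArg (fun x => (ρ' γ).hom.appLE UT UT hU.ge (τ θT) * x) hT2.symm
      _ = (ρ' γ).hom.appLE UT UT hU.ge (τ θT * affineBlowup.pull I6 UT (Tp ^ 2)) :=
          (((ρ' γ).hom.appLE UT UT hU.ge).hom.map_mul _ _).symm
      _ = (ρ' γ).hom.appLE UT UT hU.ge (affineBlowup.pull I6 UT (Hp ^ 3)) :=
          congrArg (fun x => (ρ' γ).hom.appLE UT UT hU.ge x) key
      _ = affineBlowup.pull I6 UT (Hp ^ 3) := hH3'
      _ = _ := key.symm
  have hnzd : affineBlowup.pull I6 UT (Tp ^ 2) ∈ nonZeroDivisors _ := by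
    have h := affineBlowup.pull_mem_nonZeroDivisors (I := I6) Tp hT
    change ((affineBlowup.π I6).appLE ⊤ UT le_top)
      ((Scheme.ΓSpecIso (CommRingCat.of (MvPolynomial (Fin n) k))).inv (Tp ^ 2)) ∈ _
    rw [map_pow, map_pow]
    exact pow_mem h 2
  exact (mul_cancel_right_mem_nonZeroDivisors hnzd).mp h1

include hequiv hI in
/-- **`W_T = V.basicOpen θ̃` is stable** under the lifted action. [folklore] -/
theorem preimage_chartT_eq_self (hfixT : ∀ γ : G, (ρ γ).hom.appTop ((Scheme.ΓSpecIso (CommRingCat.of (MvPolynomial (Fin n) k))).inv Tp) =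
      (Scheme.ΓSpecIso (CommRingCat.of (MvPolynomial (Fin n) k))).inv Tp) (hfixH : ∀ γ : G, (ρ γ).hom.appTop ((Scheme.ΓSpecIso (CommRingCat.of (MvPolynomial (Fin n) k))).inv Hp) =
      (Scheme.ΓSpecIso (CommRingCat.of (MvPolynomial (Fin n) k))).inv Hp) (γ : G) :
    (ρ' γ).hom ⁻¹ᵁ (affineBlowup I6).basicOpen (τ θT) = (affineBlowup I6).basicOpen (τ θT) :=
  ToricExit.preimage_basicOpen_eq_self_of_appLE_eq (ρ' γ).hom UT
    (preimage_chartOpenT_eq_self k n a b c d g hg0 hg1 hg2 hg3 hg4 hg5 hg6 hg7 ρ ρ' hequiv hI hfixT γ)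
    (τ θT) (appLE_tau_theta_eq_self k n a b c d g hg0 hg1 hg2 hg3 hg4 hg5 hg6 hg7 ρ ρ' hequiv hI hfixT hfixH γ)

include hequiv hI in
/-- **The `μ₃`-vertex chart `D₊(x_a²t)` is stable** when `x_a²` is fixed downstairs. [folklore] -/
theorem preimage_vertexChartA_eq_self (hfix0 : ∀ γ : G, (ρ γ).hom.appTop ((Scheme.ΓSpecIso (CommRingCat.of (MvPolynomial (Fin n) k))).inv (g 0)) =
      (Scheme.ΓSpecIso (CommRingCat.of (MvPolynomial (Fin n) k))).inv (g 0)) (γ : G) :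
    (ρ' γ).hom ⁻¹ᵁ Proj.basicOpen (reesGrading I6)
        (reesT (I := I6) (g 0) (Ideal.mem_span_range_self (f := g) (x := 0))) =
      Proj.basicOpen (reesGrading I6) (reesT (I := I6) (g 0) (Ideal.mem_span_range_self (f := g) (x := 0))) :=
  ToricExit.preimage_basicOpen_reesT_eq_self_of_action ρ ρ' hequiv hI _ hfix0 γ

include hequiv hI in
-- scheme-level bookkeeping on `Proj` sections: individually routine, but the types are large
set_option maxHeartbeats 800000 in
/-- **The stable affine piece `O₂` in the smooth vertex chart** (V4U-DESIGN §5): with `G` finite there is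
an affine `G`-stable open `O₂ ⊆ D₊(x_c⁶t)` with `D₊(x_a²t) ∪ W_T ∪ O₂ = V` (the intersection of the
translates of `D₊(x_c⁶t)`, `ToricExit.exists_stable_affine_cover_pair`, p487610, applied to the stable
open `D₊(x_a²t) ∪ W_T` and the three-piece cover). [OURS · L1 W4.5c] [folklore] -/
theorem exists_stable_affine_pieceC [Finite G] (hfixT : ∀ γ : G, (ρ γ).hom.appTop ((Scheme.ΓSpecIso (CommRingCat.of (MvPolynomial (Fin n) k))).inv Tp) =
      (Scheme.ΓSpecIso (CommRingCat.of (MvPolynomial (Fin n) k))).inv Tp) (hfixH : ∀ γ : G, (ρ γ).hom.appTop ((Scheme.ΓSpecIso (CommRingCat.of (MvPolynomial (Fin n) k))).inv Hp) =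
      (Scheme.ΓSpecIso (CommRingCat.of (MvPolynomial (Fin n) k))).inv Hp)
    (hfix0 : ∀ γ : G, (ρ γ).hom.appTop ((Scheme.ΓSpecIso (CommRingCat.of (MvPolynomial (Fin n) k))).inv (g 0)) =
      (Scheme.ΓSpecIso (CommRingCat.of (MvPolynomial (Fin n) k))).inv (g 0)) :
    ∃ O₂ : (affineBlowup I6).Opens, IsAffineOpen O₂ ∧ (∀ γ : G, (ρ' γ).hom ⁻¹ᵁ O₂ = O₂) ∧
      O₂ ≤ Proj.basicOpen (reesGrading I6)
        (reesT (I := I6) (g 7) (Ideal.mem_span_range_self (f := g) (x := 7))) ∧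
      Proj.basicOpen (reesGrading I6) (reesT (I := I6) (g 0) (Ideal.mem_span_range_self (f := g) (x := 0))) ⊔
        (affineBlowup I6).basicOpen (τ θT) ⊔ O₂ = ⊤ := by
  have hA : ∀ γ : G, (ρ' γ).hom ⁻¹ᵁ (Proj.basicOpen (reesGrading I6)
      (reesT (I := I6) (g 0) (Ideal.mem_span_range_self (f := g) (x := 0))) ⊔
      (affineBlowup I6).basicOpen (τ θT)) = Proj.basicOpen (reesGrading I6)
      (reesT (I := I6) (g 0) (Ideal.mem_span_range_self (f := g) (x := 0))) ⊔
      (affineBlowup I6).basicOpen (τ θT) := by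
    intro γ
    rw [Scheme.Hom.preimage_sup,
      preimage_vertexChartA_eq_self k n g ρ ρ' hequiv hI hfix0 γ,
      preimage_chartT_eq_self k n a b c d g hg0 hg1 hg2 hg3 hg4 hg5 hg6 hg7 ρ ρ' hequiv hI hfixT hfixH γ]
  have hB : IsAffineOpen (Proj.basicOpen (reesGrading I6)
      (reesT (I := I6) (g 7) (Ideal.mem_span_range_self (f := g) (x := 7)))) :=
    Proj.isAffineOpen_basicOpen _ _ (reesT_mem _ _) one_pos
  have hAB : Proj.basicOpen (reesGrading I6)
      (reesT (I := I6) (g 0) (Ideal.mem_span_range_self (f := g) (x := 0))) ⊔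
      (affineBlowup I6).basicOpen (τ θT) ⊔ Proj.basicOpen (reesGrading I6)
      (reesT (I := I6) (g 7) (Ideal.mem_span_range_self (f := g) (x := 7))) = ⊤ := by
    rw [basicOpen_tau_theta_eq_chartT k n a b c d g hg0 hg1 hg2 hg3 hg4 hg5 hg6 hg7]
    exact vertexChartA_sup_chartT_sup_vertexChartC_eq_top k n a b c d g hg0 hg1 hg2 hg3 hg4 hg5 hg6 hg7
  obtain ⟨hW, hst, hle, hcov⟩ := ToricExit.exists_stable_affine_cover_pair ρ' _ _ hA hB hAB
  exact ⟨_, hW, hst, hle, hcov⟩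

end Stability

end Summit.ResolutionOfSingularities.ResolutionOfSingularities.Theorems.WildQuotientResolution.JordanFour

end
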